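import Summits.KontsevichZagierPeriods.KontsevichZagierPeriods.Theses.RootDecompQuadraticDescent
import Literature.NumberTheory.Transcendental.BlochGroupRegulator
import Literature.NumberTheory.Transcendental.KZCubicalCalculus
import Literature.NumberTheory.Transcendental.KZSemialgebraicComplex

/-! # `RootDecompQuadraticDescentTRRogersCarvingP1` — part 1/2 of the mechanical ≤400-line split of `TRRogersCarving.lean` (sha256 ac7e0d4223a1c482…)
Source: decomp-kz lens-6 g13 TRRogersCarving.lean @ac7e0d42 (critic CLEARED g6-22 l.1373); --supports stmt-KontsevichZagierPeriods-28994.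
Split by census-1 g10 `gen/splitlean.py`: scopes re-opened with their `open`/`variable`/`set_option` context; mathematics and declaration order unchanged. -/

/-!
# TRRogersCarving — the g12 remainder of the weight-2 box `DescentTwoQ` (stmt-KontsevichZagierPeriods-28994)
# carved along the TORSION / TOTALLY-REAL ROGERS SECTOR of the Bloch group: the part where the transcendence
# input is VACUOUS by construction
(decomp-kz-lens-6 «barrier-complement carving», gen 13; route `RootDecompQuadraticDescent`, node under `DescentTwoQ`,
sub-node of the g12 remainder `OffTetraOffAreaDescentTwoQ`)

NODE.
    DescentTwoQ (28994) ⟸ TetraKernelModOne (B, g12) ∧ AreaKernelModOne (C, g12) ∧ TorsionDilogKernelModOne (T, NEW)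
                          ∧ OffTetraOffAreaOffTorsionDescentTwoQ (A″, NEW remainder)        [descentTwoQ_of_carving13]
    TorsionDilogKernelModOne ⟸ RealRelatorMoves (M, NEW, attackable)  — PROVED, no value input  [torsionDilogKernel_of_moves]
    TRDilogKernelModOne (the TOTALLY REAL Dehn-closed sector) ⟸ T  — by the tree's NAMED FACT
        `Borel1977_blochGroup_rank_le` at `r₂ = 0` (PROVED, no analytic input)               [trDilogKernel_of_torsionKernel]

THE SECTOR.  Fix a real-embedded number field `ι : F → ℝ` and a «box family» `β` realising
`Li₂(a) = ∫∫_{[0,1]²} a/(1 − a p₀ p₁) dp₀ dp₁` for real algebraic `a < 1` (the model of the landed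
`HermiteRigidity.ReductionRigidity.stub_boxFiveTerm`; chart `−[β(1/a)]` for `a > 1`).  The realisation
`Φ_β : ℤ⟨F ∖ {0,1}⟩ → KZ.FormalRep` sends Neumann's generator `[α]` to the box of `ι α`.  The TORSION-DILOGARITHM ORACLE
`T` says: for every level-1-admissible `R` (the four hypotheses of `DescentTwoQ`, verbatim), every `ξ ∈ ℤ⟨F ∖ {0,1}⟩`
whose class in the pre-Bloch group `P(F)` is TORSION, and every `y` in the level-1 decomposable closure `L₁` with
`eval(Φ_β ξ + y) = 0`, some positive multiple `N • (Φ_β ξ + y)` lies in `R`.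

WHY IT IS A BARRIER-COMPLEMENT BY CONSTRUCTION.  A torsion class needs no statement about VALUES: `N • ξ` IS a
`ℤ`-combination of five-term relators (`PreBloch.proj_eq_zero_iff`), so `T` follows from `M` alone — each five-term
relator, realised by boxes at real algebraic arguments, is an `L₁`-element modulo KZ moves (Abel / Euler / Landen /
inversion as CHAINS OF MOVES; Abel's identity at real algebraic parameters is the CLOSED tree item
`InverseLandau.FiveTermCertificate` (stmt-13875), the rational-argument chains `stub_boxFiveTerm`, `stub_boxLanden`,
`stub_eulerReflectionBox` of route HermiteRigidity are LANDED) — by the proved `oracle_glue` (push the certificate through `Φ_β`, land in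
`KZ.relations ⊔ L₁`, use the fourth admissibility hypothesis on the value-zero `L₁`-part).  HOW BIG THE SECTOR IS, is a
THEOREM: for a TOTALLY REAL `F` the Bloch group has rank `r₂ = 0` — the tree's named fact `Borel1977_blochGroup_rank_le`
(Borel 1977 + Suslin 1991; Neumann 1998 Thm 3.2; real-closed twin Dupont 2001 Thm 10.24 b)) makes EVERY Dehn-closed `ξ`
torsion (`preBloch_torsion_of_totallyReal`, PROVED from the fact, no analytic input; the kernel-form twin via `D|_ℝ = 0`
is `preBloch_torsion_of_totallyReal'`): the whole totally-real Dehn-closed sector (`TRDilogKernelModOne`, an ALGEBRAIC,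
finitely checkable hypothesis) lies inside `T` (`trDilogKernel_of_torsionKernel`), as do all torsion «ladders» of
arbitrary real-embedded number fields (Lewin).  The LEVER (Borel rank 0 + five-term engine) is that of the crux idea card
`Cruxes/HurwitzSectorComplement/Ideas/totally-real-rogers-ladders.md` (route HurwitzMicroSectors); new here is its placement as an
R-relative CARVING of the weight-2 box with the torsion input DERIVED from the tree's named fact and the glue kernel-checked.  What stays OUTSIDE, in `A″`: non-torsion Dehn-closed
classes at real places of fields with `r₂ ≥ 1` and non-Dehn-closed coincidences (both GPC-class, conjecturally vacuous),
positive-genus polar curves (`K₂`-regulators: K-M16/5), and the move-normal-form problem.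

EDGES PROVED.  `S ⟹ T` and `S ⟹ TR` exactly with `N = 1` (through the tree's `kzKernelConjecture_iff_isRational`);
`S ⟹ A″`, `28994 ⟹ A″`; `S ∧ RealRelatorValues ⟹ M` (`RealRelatorValues` = the classical value identities, an analytic
THEOREM in print, an instrument not a piece); `28994 ⟹ T` modulo the routine realisation leaf `RealDilogRealisationLE`,
`28994 ⟹ B` modulo `TetraPairRealisationLE` (g12), hence EXACTNESS `descentTwoQ_iff_carving13`; NON-VACUITY of the
box-family hypothesis (`boxFamily_exists`: honest `KZ.IntegralRep 2` with `ℚ`-semialgebraic data for every real algebraic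
`a < 1`); and the deciding chain `closes_carving13` through the route's `closes`.  0 sorry, no by-name hypothesis in the
node or in the containment `TR ⊆ T`; only the optional kernel-form twin `preBloch_torsion_of_totallyReal'` takes `D|_ℝ = 0`
(tree theorem `blochWignerDilog_ofReal`, module `BlochWignerDilogarithmProofs`, farm-unbuilt at writing) as a hypothesis.

References: Kontsevich–Zagier 2001 §1.2; Borel 1977; Suslin 1991 Thm 5.2; Neumann 1998 Prop. 2.5, Thm 3.2;
Dupont 2001 Thm 8.16, Thm 10.24 b); Dupont–Sah 1982 (5.20); Zagier 2007 Ch. I §2, Ch. II §1; Lewin 1981 Ch. 1;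
Kirillov 1995 §1; Milnor 1982 (App.); Huber–Wüstholz 2022 Thm 13.3.
-/
noncomputable section

open MeasureTheory Set MvPolynomial
open Literature.NumberTheory.Transcendental
open Literature.ModelTheory.ExponentialFields (IsSemialgebraic)
open Summit.KontsevichZagierPeriods.KontsevichZagierPeriods.Theses.RootDecompQuadraticDescent
  (DescentTwoQ KZDimTwo QuadraticDescentOne BakerFloorOne QuadraticDescent DescentThreeQ DescentFourQ DescentFromQ
    FixedDimMerge closes)

namespace Summit.KontsevichZagierPeriods.RootDecompQuadraticDescent.TRRogersCarving

/-! ## §1 The pieces (typed over TREE declarations only — verbatim-registrable in the route file) -/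

/-- **B · Bloch sector** (g12, unchanged).  [WEAKER · BARRIER] (cite Milnor1982, Appendix) (cite Neumann1998, §2.1) -/
def TetraKernelModOne : Prop :=
  ∀ R : AddSubgroup Literature.NumberTheory.Transcendental.KZ.FormalRep, Literature.NumberTheory.Transcendental.KZ.relations ≤ R → (∀ c ∈ R, ∀ y : Literature.NumberTheory.Transcendental.KZ.FormalRep, c * y ∈ R ∧ y * c ∈ R) → (∀ ⦃n m : ℕ⦄, n ≤ 1 → m ≤ 1 → ∀ (r : Literature.NumberTheory.Transcendental.KZ.IntegralRep n) (r' : Literature.NumberTheory.Transcendental.KZ.IntegralRep m), r.IsRational → r'.IsRational → r.value = r'.value → Literature.NumberTheory.Transcendental.KZ.of r - Literature.NumberTheory.Transcendental.KZ.of r' ∈ R) → (∀ x : Literature.NumberTheory.Transcendental.KZ.FormalRep, x ∈ AddSubgroup.closure ({y : Literature.NumberTheory.Transcendental.KZ.FormalRep | ∃ (a b : ℕ) (s : Literature.NumberTheory.Transcendental.KZ.IntegralRep a) (t : Literature.NumberTheory.Transcendental.KZ.IntegralRep b), a ≤ 1 ∧ b ≤ 1 ∧ a + b ≤ 2 ∧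 s.IsRational ∧ t.IsRational ∧ y = Literature.NumberTheory.Transcendental.KZ.of s * Literature.NumberTheory.Transcendental.KZ.of t} ∪ {y : Literature.NumberTheory.Transcendental.KZ.FormalRep | ∃ (k : ℕ) (u : Literature.NumberTheory.Transcendental.KZ.IntegralRep k), k ≤ 1 ∧ u.IsRational ∧ y = Literature.NumberTheory.Transcendental.KZ.of u}) → Literature.NumberTheory.Transcendental.KZ.eval x = 0 → x ∈ R) → (∀ (T : ℂ → Set (Fin 3 → ℝ)), (∀ z, T z = {p | 0 < p 1 ∧ z.re * p 1 < z.im * p 0 ∧ z.im * (p 0 - 1) < (z.re - 1) * p 1 ∧ 0 < p 2 ∧ 0 < z.im * (p 0 ^ 2 + p 1 ^ 2 + p 2 ^ 2 - p 0) + (z.re - Complex.normSq z) * p 1}) → ∀ (ρ : ℂ → Literature.NumberTheory.Transcendental.KZ.IntegralRep 3), (∀ z, IsAlgebraic ℚ z → 0 < z.im → (ρ z).domain = T z ∧ Set.EqOn (ρ z).integrand (fun p => 1 / p 2 ^ 3) (T z)) → ∀ (k : ℕ) (z : Fin k → ℂ) (n : Fin k → ℤ), (∀ i, IsAlgebraic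 ℚ (z i)) → (∀ i, 0 < (z i).im) → ∑ i, (n i : ℝ) * (ρ (z i)).value = 0 → (∑ i, n i • Literature.NumberTheory.Transcendental.KZ.of (ρ (z i))) ∈ R)

/-- **C · area sector** (g12, unchanged).  [WEAKER · ATTACKABLE, transcendence-free] (cite HuberWustholz2022, Thm 13.3) -/
def AreaKernelModOne : Prop :=
  ∀ R : AddSubgroup Literature.NumberTheory.Transcendental.KZ.FormalRep, Literature.NumberTheory.Transcendental.KZ.relations ≤ R → (∀ c ∈ R, ∀ y : Literature.NumberTheory.Transcendental.KZ.FormalRep, c * y ∈ R ∧ y * c ∈ R) → (∀ ⦃n m : ℕ⦄, n ≤ 1 → m ≤ 1 → ∀ (r : Literature.NumberTheory.Transcendental.KZ.IntegralRep n) (r' : Literature.NumberTheory.Transcendental.KZ.IntegralRep m), r.IsRational → r'.IsRational → r.value = r'.value → Literature.NumberTheory.Transcendental.KZ.of r - Literature.NumberTheory.Transcendental.KZ.of r' ∈ R) → (∀ x : Literature.NumberTheory.Transcendental.KZ.FormalRep, x ∈ AddSubgroup.closure ({y : Literature.NumberTheory.Transcendental.KZ.FormalRep | ∃ (a b : ℕ)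 (s : Literature.NumberTheory.Transcendental.KZ.IntegralRep a) (t : Literature.NumberTheory.Transcendental.KZ.IntegralRep b), a ≤ 1 ∧ b ≤ 1 ∧ a + b ≤ 2 ∧ s.IsRational ∧ t.IsRational ∧ y = Literature.NumberTheory.Transcendental.KZ.of s * Literature.NumberTheory.Transcendental.KZ.of t} ∪ {y : Literature.NumberTheory.Transcendental.KZ.FormalRep | ∃ (k : ℕ) (u : Literature.NumberTheory.Transcendental.KZ.IntegralRep k), k ≤ 1 ∧ u.IsRational ∧ y = Literature.NumberTheory.Transcendental.KZ.of u}) → Literature.NumberTheory.Transcendental.KZ.eval x = 0 → x ∈ R) → (∀ (r r' : Literature.NumberTheory.Transcendental.KZ.IntegralRep 2), (∀ p ∈ r.domain, r.integrand p = 1) → (∀ p ∈ r'.domain, r'.integrand p = 1) → r.value = r'.value → Literature.NumberTheory.Transcendental.KZ.of r - Literature.NumberTheory.Transcendental.KZ.of r' ∈ R)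

/-- **T · the TORSION-DILOGARITHM oracle** (NEW).  For every level-1-admissible `R`, every box family `β`
(`β a = [[0,1]², a/(1 − a p₀ p₁)]` for real algebraic `a < 1`), every real-embedded number field `ι : F → ℝ`, every
`ξ ∈ ℤ⟨F ∖ {0,1}⟩` with TORSION class in the pre-Bloch group `P(F)` and every `y` in the level-1 decomposable closure:
if `Φ_β ξ + y` has value `0` then a positive multiple of it lies in `R`.  Contains the whole totally-real Dehn-closed
sector (Borel, `trDilogKernel_of_torsionKernel`).  [WEAKER · leaf `RealRelatorMoves` (attackable) — `torsionDilogKernel_of_moves`]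
(cite Neumann1998, Thm 3.2) (cite Suslin1991, Thm 5.2) (cite KontsevichZagier2001, §1.2) -/
def TorsionDilogKernelModOne : Prop :=
  ∀ R : AddSubgroup Literature.NumberTheory.Transcendental.KZ.FormalRep, Literature.NumberTheory.Transcendental.KZ.relations ≤ R → (∀ c ∈ R, ∀ y : Literature.NumberTheory.Transcendental.KZ.FormalRep, c * y ∈ R ∧ y * c ∈ R) → (∀ ⦃n m : ℕ⦄, n ≤ 1 → m ≤ 1 → ∀ (r : Literature.NumberTheory.Transcendental.KZ.IntegralRep n) (r' : Literature.NumberTheory.Transcendental.KZ.IntegralRep m), r.IsRational → r'.IsRational → r.value = r'.value → Literature.NumberTheory.Transcendental.KZ.of r - Literature.NumberTheory.Transcendental.KZ.of r' ∈ R) → (∀ x : Literature.NumberTheory.Transcendental.KZ.FormalRep, x ∈ AddSubgroup.closure ({y : Literature.NumberTheory.Transcendental.KZ.FormalRep | ∃ (a b : ℕ) (s : Literature.NumberTheory.Transcendental.KZ.IntegralRep a) (t : Literature.NumberTheory.Transcendental.KZ.IntegralRep b), a ≤ 1 ∧ b ≤ 1 ∧ a + b ≤ 2 ∧ s.IsRational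 ∧ t.IsRational ∧ y = Literature.NumberTheory.Transcendental.KZ.of s * Literature.NumberTheory.Transcendental.KZ.of t} ∪ {y : Literature.NumberTheory.Transcendental.KZ.FormalRep | ∃ (k : ℕ) (u : Literature.NumberTheory.Transcendental.KZ.IntegralRep k), k ≤ 1 ∧ u.IsRational ∧ y = Literature.NumberTheory.Transcendental.KZ.of u}) → Literature.NumberTheory.Transcendental.KZ.eval x = 0 → x ∈ R) → ∀ (β : ℝ → Literature.NumberTheory.Transcendental.KZ.IntegralRep 2), (∀ a : ℝ, IsAlgebraic ℚ a → a < 1 → (β a).domain = Literature.NumberTheory.Transcendental.KZ.cube 2 ∧ Set.EqOn (β a).integrand (fun p => a / (1 - a * p 0 * p 1)) (Literature.NumberTheory.Transcendental.KZ.cube 2)) → ∀ (F : Type) [Field F] [NumberField F] (ι : F →+* ℝ), ∀ ξ : FreeAbelianGroup (Literature.NumberTheory.Transcendental.PreBloch.Gen F), (∃ N : ℕ, 0 < N ∧ N • Literature.NumberTheory.Transcendental.PreBloch.proj ξ = 0) → ∀ y ∈ AddSubgroup.closure ({y : Literature.NumberTheory.Transcendental.KZ.FormalRep | ∃ (a b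 : ℕ) (s : Literature.NumberTheory.Transcendental.KZ.IntegralRep a) (t : Literature.NumberTheory.Transcendental.KZ.IntegralRep b), a ≤ 1 ∧ b ≤ 1 ∧ a + b ≤ 2 ∧ s.IsRational ∧ t.IsRational ∧ y = Literature.NumberTheory.Transcendental.KZ.of s * Literature.NumberTheory.Transcendental.KZ.of t} ∪ {y : Literature.NumberTheory.Transcendental.KZ.FormalRep | ∃ (k : ℕ) (u : Literature.NumberTheory.Transcendental.KZ.IntegralRep k), k ≤ 1 ∧ u.IsRational ∧ y = Literature.NumberTheory.Transcendental.KZ.of u}), Literature.NumberTheory.Transcendental.KZ.eval (FreeAbelianGroup.lift (fun g : Literature.NumberTheory.Transcendental.PreBloch.Gen F => if ι g.val < 1 then Literature.NumberTheory.Transcendental.KZ.of (β (ι g.val)) else -Literature.NumberTheory.Transcendental.KZ.of (β (ι g.val)⁻¹)) ξ + y) = 0 → ∃ N : ℕ, 0 < N ∧ N • (FreeAbelianGroup.lift (fun g : Literature.NumberTheory.Transcendental.PreBloch.Gen F => if ι g.val < 1 then Literature.NumberTheory.Transcendental.KZ.of (β (ι g.val)) else -Literature.NumberTheory.Transcendental.KZ.of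 (β (ι g.val)⁻¹)) ξ + y) ∈ R

/-- **M · relator moves at real algebraic arguments** (NEW; the leaf of T).  Every five-term relator
`[x] − [y] + [y/x] − [(1−x⁻¹)/(1−y⁻¹)] + [(1−x)/(1−y)]` of a real-embedded number field, realised by boxes through the
charts (`[β a]` for `a < 1`, `−[β(1/a)]` for `a > 1`), lies in `KZ.relations ⊔ L₁`: Abel's five-term identity with its
`log·log` term, Euler's reflection, Landen and inversion as CHAINS OF KZ MOVES at real algebraic parameters.  IN THE TREE:
Abel's five-term at REAL ALGEBRAIC `x, y > 0`, `x + y < 1` is the CLOSED item `InverseLandau.FiveTermCertificate`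
(stmt-13875, `fiveTermCertificate_proof`, one combined box); rational-parameter chains `HermiteRigidity…stub_boxFiveTerm`,
`stub_boxLanden`, `stub_eulerReflectionBox`; what remains is the dictionary Neumann relator ↔ Abel form + the two charts
(Landen for `x < 0`, inversion for `x > 1`) + Euler, all at real algebraic parameters.  Same lever as the crux idea
`Cruxes/HurwitzSectorComplement/Ideas/totally-real-rogers-ladders.md` (its `RogersFiveTermChain`/`RogersEulerChain`).
[WEAKER · ATTACKABLE] (cite Zagier2007Dilogarithm, Ch. I §2) (cite KontsevichZagier2001, §1.2) -/
def RealRelatorMoves : Prop :=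
  ∀ (β : ℝ → Literature.NumberTheory.Transcendental.KZ.IntegralRep 2), (∀ a : ℝ, IsAlgebraic ℚ a → a < 1 → (β a).domain = Literature.NumberTheory.Transcendental.KZ.cube 2 ∧ Set.EqOn (β a).integrand (fun p => a / (1 - a * p 0 * p 1)) (Literature.NumberTheory.Transcendental.KZ.cube 2)) → ∀ (F : Type) [Field F] [NumberField F] (ι : F →+* ℝ), ∀ ρ ∈ Literature.NumberTheory.Transcendental.fiveTermRelators F, FreeAbelianGroup.lift (fun g : Literature.NumberTheory.Transcendental.PreBloch.Gen F => if ι g.val < 1 then Literature.NumberTheory.Transcendental.KZ.of (β (ι g.val)) else -Literature.NumberTheory.Transcendental.KZ.of (β (ι g.val)⁻¹)) ρ ∈ Literature.NumberTheory.Transcendental.KZ.relations ⊔ AddSubgroup.closure ({y : Literature.NumberTheory.Transcendental.KZ.FormalRep | ∃ (a b : ℕ) (s : Literature.NumberTheory.Transcendental.KZ.IntegralRep a) (t : Literature.NumberTheory.Transcendental.KZ.IntegralRep b), a ≤ 1 ∧ b ≤ 1 ∧ a + b ≤ 2 ∧ s.IsRational ∧ t.IsRational ∧ y = Literature.NumberTheory.Transcendental.KZ.of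 s * Literature.NumberTheory.Transcendental.KZ.of t} ∪ {y : Literature.NumberTheory.Transcendental.KZ.FormalRep | ∃ (k : ℕ) (u : Literature.NumberTheory.Transcendental.KZ.IntegralRep k), k ≤ 1 ∧ u.IsRational ∧ y = Literature.NumberTheory.Transcendental.KZ.of u})

/-- **A″ · the new remainder**: `DescentTwoQ` with THREE oracles adjoined to `R` — the tetrahedral kernel (B), the
equal-area pairs (C) and the torsion-dilogarithm kernel (T).  What it still carries: polar curves of positive genus
(`K₂`-regulators: K-M16/5), non-torsion Dehn-closed classes at real places of fields with `r₂ ≥ 1` and non-Dehn-closed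
coincidences (GPC class), and the move-normal-form problem.  [WEAKER · UNDECIDED-with-test · IDEA-NEEDED]
(cite KontsevichZagier2001, §1.2) (cite Boyd1998, §1) -/
def OffTetraOffAreaOffTorsionDescentTwoQ : Prop :=
  ∀ R : AddSubgroup Literature.NumberTheory.Transcendental.KZ.FormalRep, Literature.NumberTheory.Transcendental.KZ.relations ≤ R → (∀ c ∈ R, ∀ y : Literature.NumberTheory.Transcendental.KZ.FormalRep, c * y ∈ R ∧ y * c ∈ R) → (∀ ⦃n m : ℕ⦄, n ≤ 1 → m ≤ 1 → ∀ (r : Literature.NumberTheory.Transcendental.KZ.IntegralRep n) (r' : Literature.NumberTheory.Transcendental.KZ.IntegralRep m), r.IsRational → r'.IsRational → r.value = r'.value → Literature.NumberTheory.Transcendental.KZ.of r - Literature.NumberTheory.Transcendental.KZ.of r' ∈ R) → (∀ x : Literature.NumberTheory.Transcendental.KZ.FormalRep, x ∈ AddSubgroup.closure ({y : Literature.NumberTheory.Transcendental.KZ.FormalRep | ∃ (a b : ℕ) (s : Literature.NumberTheory.Transcendental.KZ.IntegralRep a) (t : Literature.NumberTheory.Transcendental.KZ.IntegralRep b), a ≤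 1 ∧ b ≤ 1 ∧ a + b ≤ 2 ∧ s.IsRational ∧ t.IsRational ∧ y = Literature.NumberTheory.Transcendental.KZ.of s * Literature.NumberTheory.Transcendental.KZ.of t} ∪ {y : Literature.NumberTheory.Transcendental.KZ.FormalRep | ∃ (k : ℕ) (u : Literature.NumberTheory.Transcendental.KZ.IntegralRep k), k ≤ 1 ∧ u.IsRational ∧ y = Literature.NumberTheory.Transcendental.KZ.of u}) → Literature.NumberTheory.Transcendental.KZ.eval x = 0 → x ∈ R) → (∀ (T : ℂ → Set (Fin 3 → ℝ)), (∀ z, T z = {p | 0 < p 1 ∧ z.re * p 1 < z.im * p 0 ∧ z.im * (p 0 - 1) < (z.re - 1) * p 1 ∧ 0 < p 2 ∧ 0 < z.im * (p 0 ^ 2 + p 1 ^ 2 + p 2 ^ 2 - p 0) + (z.re - Complex.normSq z) * p 1}) → ∀ (ρ : ℂ → Literature.NumberTheory.Transcendental.KZ.IntegralRep 3), (∀ z, IsAlgebraic ℚ z → 0 < z.im → (ρ z).domain = T z ∧ Set.EqOn (ρ z).integrand (fun p => 1 / p 2 ^ 3) (T z)) → ∀ (k : ℕ) (z : Fin k →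 ℂ) (n : Fin k → ℤ), (∀ i, IsAlgebraic ℚ (z i)) → (∀ i, 0 < (z i).im) → ∑ i, (n i : ℝ) * (ρ (z i)).value = 0 → (∑ i, n i • Literature.NumberTheory.Transcendental.KZ.of (ρ (z i))) ∈ R) → (∀ (r r' : Literature.NumberTheory.Transcendental.KZ.IntegralRep 2), (∀ p ∈ r.domain, r.integrand p = 1) → (∀ p ∈ r'.domain, r'.integrand p = 1) → r.value = r'.value → Literature.NumberTheory.Transcendental.KZ.of r - Literature.NumberTheory.Transcendental.KZ.of r' ∈ R) → (∀ (β : ℝ → Literature.NumberTheory.Transcendental.KZ.IntegralRep 2), (∀ a : ℝ, IsAlgebraic ℚ a → a < 1 → (β a).domain = Literature.NumberTheory.Transcendental.KZ.cube 2 ∧ Set.EqOn (β a).integrand (fun p => a / (1 - a * p 0 * p 1)) (Literature.NumberTheory.Transcendental.KZ.cube 2)) → ∀ (F : Type) [Field F] [NumberField F] (ι : F →+* ℝ), ∀ ξ : FreeAbelianGroup (Literature.NumberTheory.Transcendental.PreBloch.Gen F), (∃ N : ℕ, 0 < N ∧ N • Literature.NumberTheory.Transcendental.PreBloch.proj ξ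 = 0) → ∀ y ∈ AddSubgroup.closure ({y : Literature.NumberTheory.Transcendental.KZ.FormalRep | ∃ (a b : ℕ) (s : Literature.NumberTheory.Transcendental.KZ.IntegralRep a) (t : Literature.NumberTheory.Transcendental.KZ.IntegralRep b), a ≤ 1 ∧ b ≤ 1 ∧ a + b ≤ 2 ∧ s.IsRational ∧ t.IsRational ∧ y = Literature.NumberTheory.Transcendental.KZ.of s * Literature.NumberTheory.Transcendental.KZ.of t} ∪ {y : Literature.NumberTheory.Transcendental.KZ.FormalRep | ∃ (k : ℕ) (u : Literature.NumberTheory.Transcendental.KZ.IntegralRep k), k ≤ 1 ∧ u.IsRational ∧ y = Literature.NumberTheory.Transcendental.KZ.of u}), Literature.NumberTheory.Transcendental.KZ.eval (FreeAbelianGroup.lift (fun g : Literature.NumberTheory.Transcendental.PreBloch.Gen F => if ι g.val < 1 then Literature.NumberTheory.Transcendental.KZ.of (β (ι g.val)) else -Literature.NumberTheory.Transcendental.KZ.of (β (ι g.val)⁻¹)) ξ + y) = 0 → ∃ N : ℕ, 0 < N ∧ N • (FreeAbelianGroup.lift (fun g : Literature.NumberTheory.Transcendental.PreBloch.Gen F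 => if ι g.val < 1 then Literature.NumberTheory.Transcendental.KZ.of (β (ι g.val)) else -Literature.NumberTheory.Transcendental.KZ.of (β (ι g.val)⁻¹)) ξ + y) ∈ R) → ∀ ⦃n m : ℕ⦄, n ≤ 2 → m ≤ 2 → ∀ (r : Literature.NumberTheory.Transcendental.KZ.IntegralRep n) (r' : Literature.NumberTheory.Transcendental.KZ.IntegralRep m), r.IsRational → r'.IsRational → r.value = r'.value → Literature.NumberTheory.Transcendental.KZ.of r - Literature.NumberTheory.Transcendental.KZ.of r' ∈ R

/-- **TR · the TOTALLY REAL Dehn-closed sector** (sub-oracle of T with an ALGEBRAIC, finitely checkable hypothesis; NOT a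
separate piece of the node): for a totally real number field (Mathlib `NumberField.IsTotallyReal`: every infinite place is
real) and a DEHN-CLOSED `ξ` (every wedge pairing `PreBloch.wedgePairing u v` kills `ξ`), value zero forces a positive
multiple into `R`.  `T ⟹ TR` by Borel's rank theorem with `r₂ = 0` (`trDilogKernel_of_torsionKernel`, from the tree's
named fact `Borel1977_blochGroup_rank_le`, no analytic input). (cite Neumann1998, Thm 3.2) (cite Dupont2001, Thm 10.24) -/
def TRDilogKernelModOne : Prop :=
  ∀ R : AddSubgroup Literature.NumberTheory.Transcendental.KZ.FormalRep, Literature.NumberTheory.Transcendental.KZ.relations ≤ R → (∀ c ∈ R, ∀ y : Literature.NumberTheory.Transcendental.KZ.FormalRep, c * y ∈ R ∧ y * c ∈ R) → (∀ ⦃n m : ℕ⦄, n ≤ 1 → m ≤ 1 → ∀ (r : Literature.NumberTheory.Transcendental.KZ.IntegralRep n) (r' : Literature.NumberTheory.Transcendental.KZ.IntegralRep m), r.IsRational → r'.IsRational → r.value = r'.value → Literature.NumberTheory.Transcendental.KZ.of r - Literature.NumberTheory.Transcendental.KZ.of r' ∈ R) → (∀ x : Literature.NumberTheory.Transcendental.KZ.FormalRep,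 x ∈ AddSubgroup.closure ({y : Literature.NumberTheory.Transcendental.KZ.FormalRep | ∃ (a b : ℕ) (s : Literature.NumberTheory.Transcendental.KZ.IntegralRep a) (t : Literature.NumberTheory.Transcendental.KZ.IntegralRep b), a ≤ 1 ∧ b ≤ 1 ∧ a + b ≤ 2 ∧ s.IsRational ∧ t.IsRational ∧ y = Literature.NumberTheory.Transcendental.KZ.of s * Literature.NumberTheory.Transcendental.KZ.of t} ∪ {y : Literature.NumberTheory.Transcendental.KZ.FormalRep | ∃ (k : ℕ) (u : Literature.NumberTheory.Transcendental.KZ.IntegralRep k), k ≤ 1 ∧ u.IsRational ∧ y = Literature.NumberTheory.Transcendental.KZ.of u}) → Literature.NumberTheory.Transcendental.KZ.eval x = 0 → x ∈ R) → ∀ (β : ℝ → Literature.NumberTheory.Transcendental.KZ.IntegralRep 2), (∀ a : ℝ, IsAlgebraic ℚ a → a < 1 → (β a).domain = Literature.NumberTheory.Transcendental.KZ.cube 2 ∧ Set.EqOn (β a).integrand (fun p => a / (1 - a * p 0 * p 1)) (Literature.NumberTheory.Transcendental.KZ.cube 2)) → ∀ (F : Type) [Field F] [NumberField F] [NumberField.IsTotallyReal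 F] (ι : F →+* ℝ), ∀ ξ : FreeAbelianGroup (Literature.NumberTheory.Transcendental.PreBloch.Gen F), (∀ u v : Additive Fˣ →+ ℚ, Literature.NumberTheory.Transcendental.PreBloch.wedgePairing u v ξ = 0) → ∀ y ∈ AddSubgroup.closure ({y : Literature.NumberTheory.Transcendental.KZ.FormalRep | ∃ (a b : ℕ) (s : Literature.NumberTheory.Transcendental.KZ.IntegralRep a) (t : Literature.NumberTheory.Transcendental.KZ.IntegralRep b), a ≤ 1 ∧ b ≤ 1 ∧ a + b ≤ 2 ∧ s.IsRational ∧ t.IsRational ∧ y = Literature.NumberTheory.Transcendental.KZ.of s * Literature.NumberTheory.Transcendental.KZ.of t} ∪ {y : Literature.NumberTheory.Transcendental.KZ.FormalRep | ∃ (k : ℕ) (u : Literature.NumberTheory.Transcendental.KZ.IntegralRep k), k ≤ 1 ∧ u.IsRational ∧ y = Literature.NumberTheory.Transcendental.KZ.of u}), Literature.NumberTheory.Transcendental.KZ.eval (FreeAbelianGroup.lift (fun g : Literature.NumberTheory.Transcendental.PreBloch.Gen F => if ι g.val < 1 then Literature.NumberTheory.Transcendental.KZ.of (β (ι g.val)) else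 -Literature.NumberTheory.Transcendental.KZ.of (β (ι g.val)⁻¹)) ξ + y) = 0 → ∃ N : ℕ, 0 < N ∧ N • (FreeAbelianGroup.lift (fun g : Literature.NumberTheory.Transcendental.PreBloch.Gen F => if ι g.val < 1 then Literature.NumberTheory.Transcendental.KZ.of (β (ι g.val)) else -Literature.NumberTheory.Transcendental.KZ.of (β (ι g.val)⁻¹)) ξ + y) ∈ R

/-! ## §2 Glue and the cheap edges -/

/-- GLUE (modus ponens inside `∀ R`): the four pieces give `DescentTwoQ` back. [folklore] -/
theorem descentTwoQ_of_carving13 (hB : TetraKernelModOne) (hC : AreaKernelModOne) (hT : TorsionDilogKernelModOne)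
    (hA : OffTetraOffAreaOffTorsionDescentTwoQ) : DescentTwoQ := by
  intro R h₁ h₂ h₃ h₄
  exact hA R h₁ h₂ h₃ h₄ (hB R h₁ h₂ h₃ h₄) (hC R h₁ h₂ h₃ h₄) (hT R h₁ h₂ h₃ h₄)

/-- Edge `DescentTwoQ → A″` (drop the three adjoined oracles). [folklore] -/
theorem offTorsion_of_descentTwoQ (h : DescentTwoQ) : OffTetraOffAreaOffTorsionDescentTwoQ := by
  intro R h₁ h₂ h₃ h₄ _ _ _
  exact h R h₁ h₂ h₃ h₄

/-- An integral representation with integrand `1` on its domain has KZ's rational shape. (cite KontsevichZagier2001, §1.1) -/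
private theorem isRational_of_integrand_eq_one {d : ℕ} {r : KZ.IntegralRep d} (h : ∀ p ∈ r.domain, r.integrand p = 1) :
    r.IsRational :=
  ⟨1, 1, fun x _ => by simp, fun x hx => by simp [h x hx]⟩

/-- Edge `DescentTwoQ → C` (restriction). [folklore] -/
theorem areaKernelModOne_of_descentTwoQ (h : DescentTwoQ) : AreaKernelModOne := by
  intro R h₁ h₂ h₃ h₄ r r' hr hr' hv
  exact h R h₁ h₂ h₃ h₄ le_rfl le_rfl r r' (isRational_of_integrand_eq_one hr)
    (isRational_of_integrand_eq_one hr') hv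

/-! ## §3 `T ⟸ M` (the inner glue, PROVED — no value input) and the containment `TR ⊆ T` (Borel rank `r₂ = 0`) -/

/-- **The oracle glue.**  If `Φ` maps every relator into `KZ.relations ⊔ L` and `N • ξ ∈ ⟨relators⟩`, then for every
`y ∈ L` with `eval (Φ ξ + y) = 0` the multiple `N • (Φ ξ + y)` lies in every `R ⊇ KZ.relations` containing the
value-zero elements of `L`: write `Φ(N•ξ) = r + y'` (`r` a relation, `y' ∈ L`); then `N•(Φ ξ + y) = r + (y' + N•y)` and
`y' + N•y ∈ L` has value `0` by soundness of the moves. (cite KontsevichZagier2001, §1.2) -/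
theorem oracle_glue {G : Type*} [AddCommGroup G] (R : AddSubgroup KZ.FormalRep) (h₁ : KZ.relations ≤ R)
    (L : AddSubgroup KZ.FormalRep) (h₄ : ∀ x : KZ.FormalRep, x ∈ L → KZ.eval x = 0 → x ∈ R)
    (Φ : G →+ KZ.FormalRep) (rels : Set G) (hrel : ∀ ρ ∈ rels, Φ ρ ∈ KZ.relations ⊔ L) {ξ : G} {N : ℕ}
    (hmem : N • ξ ∈ AddSubgroup.closure rels) {y : KZ.FormalRep} (hy : y ∈ L) (hev : KZ.eval (Φ ξ + y) = 0) :
    N • (Φ ξ + y) ∈ R := by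
  have hle : AddSubgroup.closure rels ≤ (KZ.relations ⊔ L).comap Φ :=
    (AddSubgroup.closure_le _).2 fun ρ hρ => AddSubgroup.mem_comap.2 (hrel ρ hρ)
  have hΦ : Φ (N • ξ) ∈ KZ.relations ⊔ L := AddSubgroup.mem_comap.1 (hle hmem)
  obtain ⟨r, hr, y', hy', hsum⟩ := AddSubgroup.mem_sup.1 hΦ
  have hr0 : KZ.eval r = 0 := by
    have h := KZ.relations_le_ker_eval_holds hr
    rwa [AddMonoidHom.mem_ker] at h
  have e : N • (Φ ξ + y) = r + (y' + N • y) := by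
    rw [smul_add, ← map_nsmul, ← hsum, add_assoc]
  have hev' : KZ.eval (y' + N • y) = 0 := by
    have h0 : KZ.eval (N • (Φ ξ + y)) = 0 := by rw [map_nsmul, hev, smul_zero]
    rwa [e, map_add, hr0, zero_add] at h0
  rw [e]
  exact R.add_mem (h₁ hr) (h₄ _ (L.add_mem hy' (L.nsmul_mem hy N)) hev')

/-- **`T ⟸ M`**: the torsion-dilogarithm oracle from the relator moves ALONE — a torsion class `N • [ξ] = 0` in `P(F)`
means `N • ξ ∈ ⟨five-term relators⟩` (`PreBloch.proj_eq_zero_iff`); push through `Φ_β` with `oracle_glue`.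
(cite Neumann1998, eq. (2.3)) (cite KontsevichZagier2001, §1.2) -/
theorem torsionDilogKernel_of_moves (hM : RealRelatorMoves) : TorsionDilogKernelModOne := by
  intro R h₁ _ _ h₄ β hβ F _ _ ι ξ hξ y hy hev
  obtain ⟨N, hN, hNξ⟩ := hξ
  have hmem : N • ξ ∈ AddSubgroup.closure (fiveTermRelators F) := by
    rw [← PreBloch.proj_eq_zero_iff, map_nsmul]
    exact hNξ
  exact ⟨N, hN, oracle_glue R h₁ _ h₄ _ (fiveTermRelators F) (hM β hβ F ι) hmem hy hev⟩

/-- Torsion bookkeeping: `n • (k • x) = 0` with `n > 0`, `k ≠ 0` gives a positive `ℕ`-multiple of `x` equal to `0`. [folklore] -/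
theorem torsion_of_nsmul_zsmul {A : Type*} [AddCommGroup A] {x : A} {n : ℕ} {k : ℤ} (hn : 0 < n) (hk : k ≠ 0)
    (h : n • (k • x) = 0) : ∃ N : ℕ, 0 < N ∧ N • x = 0 := by
  refine ⟨n * k.natAbs, Nat.mul_pos hn (Int.natAbs_pos.2 hk), ?_⟩
  rcases Int.natAbs_eq k with e | e
  · rw [e, natCast_zsmul, smul_smul] at h
    exact h
  · rw [e, neg_smul, natCast_zsmul, smul_neg, neg_eq_zero, smul_smul] at h
    exact h

/-- **Borel–Suslin for totally real fields** (from the tree's named RANK fact, `dim_ℚ B(F) ⊗ ℚ ≤ r₂`, at `r₂ = 0`): in a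
totally real number field every Dehn-closed `ξ ∈ ℤ⟨F ∖ {0,1}⟩` has TORSION class in the pre-Bloch group `P(F)` — no
analytic input at all (Dupont 2001, Thm 10.24 b) is the real-closed statement). (cite Neumann1998, Thm 3.2) (cite Dupont2001, Thm 10.24) -/
theorem preBloch_torsion_of_totallyReal (hBo : Borel1977_blochGroup_rank_le) (F : Type) [Field F] [NumberField F]
    [NumberField.IsTotallyReal F] (ξ : FreeAbelianGroup (PreBloch.Gen F))
    (hD : ∀ u v : Additive Fˣ →+ ℚ, PreBloch.wedgePairing u v ξ = 0) : ∃ N : ℕ, 0 < N ∧ N • PreBloch.proj ξ = 0 := by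
  obtain ⟨a, ha, n, hn, hξ⟩ := hBo F 1 (fun _ => ξ) (fun _ => hD)
    (by rw [NumberField.IsTotallyReal.nrComplexPlaces_eq_zero F]; exact Nat.one_pos)
  rw [Fin.sum_univ_one, map_zsmul] at hξ
  have ha0 : a 0 ≠ 0 := fun h => ha (funext fun j => by rw [Subsingleton.elim j 0]; exact h)
  exact torsion_of_nsmul_zsmul hn ha0 hξ

/-- For a totally real field every component of the Borel regulator vanishes identically: `D(σ α) = D(real) = 0`
(the KERNEL-form route to the same torsion statement).  The input `D|_ℝ = 0` is the tree theorem
`blochWignerDilog_ofReal` (module `BlochWignerDilogarithmProofs`), taken BY NAME as a hypothesis because that module is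
farm-unbuilt at writing (its `x ≤ 1` half `blochWignerDilog_ofReal_of_le_one` is built and used below).
(cite Neumann1998, Thm 3.2) -/
theorem regulatorAt_eq_zero_of_totallyReal (hBW : ∀ x : ℝ, blochWignerDilog (x : ℂ) = 0) {F : Type*} [Field F]
    [NumberField F] [NumberField.IsTotallyReal F] (σ : F →+* ℂ) (ξ : FreeAbelianGroup (PreBloch.Gen F)) :
    PreBloch.regulatorAt σ ξ = 0 := by
  induction ξ using FreeAbelianGroup.induction_on with
  | zero => exact map_zero _
  | of g =>
    rw [PreBloch.regulatorAt_of,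
      ← (NumberField.IsTotallyReal.complexEmbedding_isReal σ).coe_embedding_apply g.val]
    exact hBW _
  | neg g ih => rw [map_neg, ih, neg_zero]
  | add x y hx hy => rw [map_add, hx, hy, add_zero]

/-- A generator `[α]` with `σ α ≤ 1` contributes `D(σ α) = 0` — this half needs only the BUILT `D|_{(-∞,1]} = 0`.
(cite Neumann1998, Thm 3.2) -/
theorem regulatorAt_of_eq_zero_of_le_one {F : Type*} [Field F] [NumberField F] [NumberField.IsTotallyReal F]
    (σ : F →+* ℂ) (g : PreBloch.Gen F)
    (hle : (NumberField.IsTotallyReal.complexEmbedding_isReal σ).embedding g.val ≤ 1) :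
    PreBloch.regulatorAt σ (FreeAbelianGroup.of g) = 0 := by
  rw [PreBloch.regulatorAt_of, ← (NumberField.IsTotallyReal.complexEmbedding_isReal σ).coe_embedding_apply g.val]
  exact blochWignerDilog_ofReal_of_le_one hle

/-- The kernel-form derivation of the same torsion statement (Borel KERNEL fact + `D|_ℝ = 0`). (cite Neumann1998, Thm 3.2) -/
theorem preBloch_torsion_of_totallyReal' (hBo : Borel1977_blochGroup_regulator_kernel_torsion)
    (hBW : ∀ x : ℝ, blochWignerDilog (x : ℂ) = 0) (F : Type) [Field F] [NumberField F] [NumberField.IsTotallyReal F]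
    (ξ : FreeAbelianGroup (PreBloch.Gen F)) (hD : ∀ u v : Additive Fˣ →+ ℚ, PreBloch.wedgePairing u v ξ = 0) :
    ∃ N : ℕ, 0 < N ∧ N • PreBloch.proj ξ = 0 :=
  hBo F ξ hD (fun σ => regulatorAt_eq_zero_of_totallyReal hBW σ ξ)

/-- **`TR ⊆ T`**: the totally-real Dehn-closed sector is contained in the torsion sector (Borel rank `r₂ = 0`), so the
oracle `T` decides it — NO analytic or by-name input. (cite Neumann1998, Thm 3.2) -/
theorem trDilogKernel_of_torsionKernel (hBo : Borel1977_blochGroup_rank_le) (hT : TorsionDilogKernelModOne) :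
    TRDilogKernelModOne := by
  intro R h₁ h₂ h₃ h₄ β hβ F _ _ _ ι ξ hD y hy hev
  exact hT R h₁ h₂ h₃ h₄ β hβ F ι ξ (preBloch_torsion_of_totallyReal hBo F ξ hD) y hy hev

/-- Hence `TR ⟸ Borel(rank) ∧ M`. [folklore] -/
theorem trDilogKernel_of_moves (hBo : Borel1977_blochGroup_rank_le) (hM : RealRelatorMoves) : TRDilogKernelModOne :=
  trDilogKernel_of_torsionKernel hBo (torsionDilogKernel_of_moves hM)

/-! ## §4 Summit edges and the value instrument -/

/-- `T` is implied by the kernel form of Conjecture 1, with `N = 1`. (cite KontsevichZagier2001, §1.2) -/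
theorem torsionDilogKernel_of_kernelConjecture (h : KZKernelConjecture) : TorsionDilogKernelModOne := by
  intro R h₁ _ _ _ β _ F _ _ ι ξ _ y _ hev
  exact ⟨1, one_pos, by rw [one_nsmul]; exact h₁ (h _ hev)⟩

/-- `T` is summit-implied (S ⟺ kernel form, tree `kzKernelConjecture_iff_isRational`). (cite KontsevichZagier2001, §1.2) -/
theorem torsionDilogKernel_of_summit (h : KontsevichZagierPeriods) : TorsionDilogKernelModOne :=
  torsionDilogKernel_of_kernelConjecture (kzKernelConjecture_iff_isRational.mpr (KontsevichZagierPeriods_iff.mp h))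

/-- `TR` is implied by the kernel form of Conjecture 1, with `N = 1`. (cite KontsevichZagier2001, §1.2) -/
theorem trDilogKernel_of_kernelConjecture (h : KZKernelConjecture) : TRDilogKernelModOne := by
  intro R h₁ _ _ _ β _ F _ _ _ ι ξ _ y _ hev
  exact ⟨1, one_pos, by rw [one_nsmul]; exact h₁ (h _ hev)⟩

/-- `TR` is summit-implied. (cite KontsevichZagier2001, §1.2) -/
theorem trDilogKernel_of_summit (h : KontsevichZagierPeriods) : TRDilogKernelModOne :=
  trDilogKernel_of_kernelConjecture (kzKernelConjecture_iff_isRational.mpr (KontsevichZagierPeriods_iff.mp h))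

/-- `DescentTwoQ` is summit-implied. (cite KontsevichZagier2001, §1.2) -/
theorem descentTwoQ_of_summit (h : KontsevichZagierPeriods) : DescentTwoQ := by
  intro R h₁ _ _ _ n m _ _ r r' hr hr' hv
  exact h₁ (KontsevichZagierPeriods_iff.mp h r r' hr hr' hv)

/-- `A″` is summit-implied. [folklore] -/
theorem offTorsion_of_summit (h : KontsevichZagierPeriods) : OffTetraOffAreaOffTorsionDescentTwoQ :=
  offTorsion_of_descentTwoQ (descentTwoQ_of_summit h)

/-- `C` is summit-implied. [folklore] -/
theorem areaKernelModOne_of_summit (h : KontsevichZagierPeriods) : AreaKernelModOne :=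
  areaKernelModOne_of_descentTwoQ (descentTwoQ_of_summit h)

/-- INSTRUMENT (NOT a piece): **the classical value identities** — every five-term relator of a real-embedded number
field, realised by boxes through the charts, has the value of some element of the level-1 decomposable closure
(a `ℤ`-combination of `log a · log b`, `a, b` positive real algebraic, and of `ℚπ²`): Abel's identity
`Li₂(x)+Li₂(y)−Li₂(xy)−Li₂(x(1−y)/(1−xy))−Li₂(y(1−x)/(1−xy)) = log((1−x)/(1−xy))·log((1−y)/(1−xy))`, Euler's
reflection, Landen's identity and inversion.  An ANALYTIC THEOREM in print (the Bloch–Wigner analogue is the tree's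
`blochWignerDilog_five_term`). (cite Zagier2007Dilogarithm, Ch. I §2) -/
def RealRelatorValues : Prop :=
  ∀ (β : ℝ → Literature.NumberTheory.Transcendental.KZ.IntegralRep 2), (∀ a : ℝ, IsAlgebraic ℚ a → a < 1 → (β a).domain = Literature.NumberTheory.Transcendental.KZ.cube 2 ∧ Set.EqOn (β a).integrand (fun p => a / (1 - a * p 0 * p 1)) (Literature.NumberTheory.Transcendental.KZ.cube 2)) → ∀ (F : Type) [Field F] [NumberField F] (ι : F →+* ℝ), ∀ ρ ∈ Literature.NumberTheory.Transcendental.fiveTermRelators F, ∃ y ∈ AddSubgroup.closure ({y : Literature.NumberTheory.Transcendental.KZ.FormalRep | ∃ (a b : ℕ) (s : Literature.NumberTheory.Transcendental.KZ.IntegralRep a) (t : Literature.NumberTheory.Transcendental.KZ.IntegralRep b), a ≤ 1 ∧ b ≤ 1 ∧ a + b ≤ 2 ∧ s.IsRational ∧ t.IsRational ∧ y = Literature.NumberTheory.Transcendental.KZ.of s * Literature.NumberTheory.Transcendental.KZ.of t} ∪ {y : Literature.NumberTheory.Transcendental.KZ.FormalRep | ∃ (k : ℕ) (u : Literature.NumberTheory.Transcendental.KZ.IntegralRep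 k), k ≤ 1 ∧ u.IsRational ∧ y = Literature.NumberTheory.Transcendental.KZ.of u}), Literature.NumberTheory.Transcendental.KZ.eval (FreeAbelianGroup.lift (fun g : Literature.NumberTheory.Transcendental.PreBloch.Gen F => if ι g.val < 1 then Literature.NumberTheory.Transcendental.KZ.of (β (ι g.val)) else -Literature.NumberTheory.Transcendental.KZ.of (β (ι g.val)⁻¹)) ρ + y) = 0

/-- `M` is implied by the kernel form of Conjecture 1 together with the classical value identities. (cite KontsevichZagier2001, §1.2) -/
theorem realRelatorMoves_of_kernelConjecture (h : KZKernelConjecture) (hV : RealRelatorValues) : RealRelatorMoves := by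
  intro β hβ F _ _ ι ρ hρ
  obtain ⟨y, hy, hev⟩ := hV β hβ F ι ρ hρ
  have hrel := h _ hev
  refine AddSubgroup.mem_sup.2 ⟨_, hrel, -y, AddSubgroup.neg_mem _ hy, ?_⟩
  abel

/-- `M` is summit-implied given the classical value identities. [folklore] -/
theorem realRelatorMoves_of_summit (h : KontsevichZagierPeriods) (hV : RealRelatorValues) : RealRelatorMoves :=
  realRelatorMoves_of_kernelConjecture (kzKernelConjecture_iff_isRational.mpr (KontsevichZagierPeriods_iff.mp h)) hV

/-! ## §5 Necessity edges for B and T modulo routine realisation leaves; exactness -/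

/-- Routine leaf (g12 §5): every `ℤ`-combination of standard tetrahedra is KZ-congruent to `[r] − [r']`, `r, r'`
ℚ-rational of dimensions `≤ 2` (reduced in g12 to `FixedDimMergeTwo ∧ SingleTetraRational`). (cite KontsevichZagier2001, §1.2) -/
def TetraPairRealisationLE : Prop :=
  ∀ (T : ℂ → Set (Fin 3 → ℝ)), (∀ z, T z = {p | 0 < p 1 ∧ z.re * p 1 < z.im * p 0 ∧ z.im * (p 0 - 1) < (z.re - 1) * p 1 ∧ 0 < p 2 ∧ 0 < z.im * (p 0 ^ 2 + p 1 ^ 2 + p 2 ^ 2 - p 0) + (z.re - Complex.normSq z) * p 1}) → ∀ (ρ : ℂ → Literature.NumberTheory.Transcendental.KZ.IntegralRep 3), (∀ z, IsAlgebraic ℚ z → 0 < z.im → (ρ z).domain = T z ∧ Set.EqOn (ρ z).integrand (fun p => 1 / p 2 ^ 3) (T z)) → ∀ (k : ℕ) (z : Fin k → ℂ) (n : Fin k → ℤ), (∀ i, IsAlgebraic ℚ (z i)) → (∀ i, 0 < (z i).im) → ∃ (a : ℕ) (r : Literature.NumberTheory.Transcendental.KZ.IntegralRep a) (b : ℕ)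 (r' : Literature.NumberTheory.Transcendental.KZ.IntegralRep b), a ≤ 2 ∧ b ≤ 2 ∧ r.IsRational ∧ r'.IsRational ∧ Literature.NumberTheory.Transcendental.KZ.of r - Literature.NumberTheory.Transcendental.KZ.of r' - ∑ i, n i • Literature.NumberTheory.Transcendental.KZ.of (ρ (z i)) ∈ Literature.NumberTheory.Transcendental.KZ.relations

/-- Routine leaf (NEW, value-free and S-free): every element `Φ_β ξ + y` of the real dilogarithm sector is
KZ-congruent to `[r] − [r']`, `r, r'` ℚ-rational of dimensions `≤ 2`.  Reduction: the scaling move `u = a·p₁` turns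
the box `[β a]` into the ℚ-RATIONAL representation `[{0<x<1, 0<u<a}, 1/(1−xu)]` (algebraic endpoint, rational
integrand); the generators of `L₁` are ℚ-rational already; then merge (`FixedDimMerge` at `d = 2`, item 28143).
(cite KontsevichZagier2001, §1.1) -/
def RealDilogRealisationLE : Prop :=
  ∀ (β : ℝ → Literature.NumberTheory.Transcendental.KZ.IntegralRep 2), (∀ a : ℝ, IsAlgebraic ℚ a → a < 1 → (β a).domain = Literature.NumberTheory.Transcendental.KZ.cube 2 ∧ Set.EqOn (β a).integrand (fun p => a / (1 - a * p 0 * p 1)) (Literature.NumberTheory.Transcendental.KZ.cube 2)) → ∀ (F : Type) [Field F] [NumberField F] (ι : F →+* ℝ), ∀ ξ : FreeAbelianGroup (Literature.NumberTheory.Transcendental.PreBloch.Gen F), ∀ y ∈ AddSubgroup.closure ({y : Literature.NumberTheory.Transcendental.KZ.FormalRep | ∃ (a b : ℕ) (s : Literature.NumberTheory.Transcendental.KZ.IntegralRep a) (t : Literature.NumberTheory.Transcendental.KZ.IntegralRep b), a ≤ 1 ∧ b ≤ 1 ∧ a + b ≤ 2 ∧ s.IsRational ∧ t.IsRational ∧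 y = Literature.NumberTheory.Transcendental.KZ.of s * Literature.NumberTheory.Transcendental.KZ.of t} ∪ {y : Literature.NumberTheory.Transcendental.KZ.FormalRep | ∃ (k : ℕ) (u : Literature.NumberTheory.Transcendental.KZ.IntegralRep k), k ≤ 1 ∧ u.IsRational ∧ y = Literature.NumberTheory.Transcendental.KZ.of u}), ∃ (a : ℕ) (r : Literature.NumberTheory.Transcendental.KZ.IntegralRep a) (b : ℕ) (r' : Literature.NumberTheory.Transcendental.KZ.IntegralRep b), a ≤ 2 ∧ b ≤ 2 ∧ r.IsRational ∧ r'.IsRational ∧ Literature.NumberTheory.Transcendental.KZ.of r - Literature.NumberTheory.Transcendental.KZ.of r' - (FreeAbelianGroup.lift (fun g : Literature.NumberTheory.Transcendental.PreBloch.Gen F => if ι g.val < 1 then Literature.NumberTheory.Transcendental.KZ.of (β (ι g.val)) else -Literature.NumberTheory.Transcendental.KZ.of (β (ι g.val)⁻¹)) ξ + y) ∈ Literature.NumberTheory.Transcendental.KZ.relations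

/-- The value of a `ℤ`-combination of representations. (cite KontsevichZagier2001, §1.2) -/
theorem eval_sum_zsmul_of {k : ℕ} (ρ : ℂ → KZ.IntegralRep 3) (z : Fin k → ℂ) (n : Fin k → ℤ) :
    KZ.eval (∑ i, n i • KZ.of (ρ (z i))) = ∑ i, (n i : ℝ) * (ρ (z i)).value := by
  simp [map_sum, map_zsmul, KZ.eval_of, zsmul_eq_mul]

/-- Edge `DescentTwoQ → B` from the `≤ 2` realisation (g12). [folklore] -/
theorem tetraKernelModOne_of_descentTwoQ_le (hP : TetraPairRealisationLE) (h : DescentTwoQ) :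
    TetraKernelModOne := by
  intro R h₁ h₂ h₃ h₄ T hT ρ hρ k z n ha hi hs
  obtain ⟨a, r, b, r', ha2, hb2, hr, hr', hrel⟩ := hP T hT ρ hρ k z n ha hi
  have hker := KZ.relations_le_ker_eval_holds hrel
  rw [AddMonoidHom.mem_ker, map_sub, map_sub, KZ.eval_of, KZ.eval_of, eval_sum_zsmul_of, hs, sub_zero,
    sub_eq_zero] at hker
  have hR : KZ.of r - KZ.of r' ∈ R := h R h₁ h₂ h₃ h₄ ha2 hb2 r r' hr hr' hker
  have : (∑ i, n i • KZ.of (ρ (z i))) = (KZ.of r - KZ.of r') - (KZ.of r - KZ.of r' - ∑ i, n i • KZ.of (ρ (z i))) := by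
    abel
  rw [this]
  exact R.sub_mem hR (h₁ hrel)

end Summit.KontsevichZagierPeriods.RootDecompQuadraticDescent.TRRogersCarving
end
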